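import Summits.BirchSwinnertonDyer.BirchSwinnertonDyer.Theorems.SylvesterTwoHeegnerIndexYinLower
import HarnessLib

/-!
# Route `SylvesterTwoHeegnerIndex` (rung K7t), LOWER cruxes 19891 / 19892: the LOCAL form of the
# single-curve residual (low) — «non-divisibility of Yin's point over SOME extension field (e.g. a
# completion `K_𝔭`, `𝔭 = 2𝒪_K`) suffices» — part IV of `…YinLower`

Cell `bsd-cm`, seat `bsd-cm-k7t-c2` (prover-bsd-cm-k7t-c2-g9-0; planner D177: «a typed LOCAL statement
(memo §22 Cor 22.1) … would be the natural next file»). PARTITION (D-0054): CornerF at `p = 2` (B14/O12)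
× 𝒞_HSY × `p = 2` — types-the-object-of (kernel, `--supports stmt-BirchSwinnertonDyer-19892`); closes no
cell and no item; BSD is not claimed. Everything here is PROVED: no definition, no named fact, no `sorry`.

THE POINT. (low) (part I, module docstring) asks, at every display datum `(K ∋ ω, P₀, Y, u)`, that Yin's
point `Y ∈ E_p(K)` is NOT `2^j`-divisible modulo torsion for the `j` with `2j + 2δ > ord₂ #Ш(E_p)[2^∞]`.
Non-divisibility is inherited from ANY extension: if `ι_L Y ∉ 2^j·E_p(L) + tors` for some field `L ⊇ K`
of characteristic `0` (a completion `K_v`, an algebraic closure of one, …) then `Y ∉ 2^j·E_p(K) + tors`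
(`ι_L : E_p(K) → E_p(L)` is a homomorphism carrying torsion to torsion — one line). So the displayed
LOCAL residual

* **(lowLoc)** — granted `PublishedFactsTwo`: at every display datum and every `j` with
  `ord₂ #Ш(B)[2^∞] + 1 ≤ 2j + 2δ`, there is SOME extension field `L/K` of characteristic `0` over which
  `ι_L Y ∉ 2^j·B(L) + tors`

implies (low) (`low_of_lowLocal`), hence the LOWER cruxes 19477 / 19891 / 19892 BY NAME
(`lowerOfFacts_of_yin_of_lowLocal`, `lowerOnV0HSY_of_yin_of_lowLocal`, `lowerOffV0HSY_of_yin_of_lowLocal`).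
This is the SHAPE in which the only named road to (low) would deliver it: memo two §22.1 (L)/(K) and
Cor 22.1 — on 𝒰 ∩ {rk₂ Cl(ℚ(∛4p)) = 0} the `2`-Selmer group of `E_p/K` injects into `E_p(K_𝔭)/2`,
`𝔭 = 2𝒪_K` (the inert prime, `K_𝔭 = ℚ₄`), so there (low) ⟺ «`Y ∉ 2E_p(ℚ₄)`» ⟺ `v₂(log_Ê(9Y)) = 1` — a
`2`-ADIC CM-VALUE statement, i.e. exactly what a `2`-adic Rubin/BKOY-type formula at the inert
supersingular prime `2` (Burungale–Kobayashi–Ota–Yasuda 2023 Thm 1.1 is `p ≥ 5`; NO PRINT at `p = 2`,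
planner D177 road (a)) would have to output. That converse (local ⟸ global on the stated locus) is a
`2`-descent statement (memo Thm A: `Sel₂ = N₁ = 0` when `k = 0`), NOT proved here and not in the tree.

HONEST READING. (lowLoc) is formally STRONGER than (low) (take `L := K`… is not allowed to conclude
anything new: indeed (low) ⟹ (lowLoc) trivially with `L = K`, `lowLocal_of_low`, so the two are
EQUIVALENT — the content of the file is the packaging: a hand that proves non-divisibility `2`-ADICALLY
(or over any convenient extension) closes the LOWER cruxes by name through this file. Nothing decided.

## References
* H. Yin, arXiv:2607.01744 (2026), Thm. 1.1, (3.5.3) (PREPRINT display shape `YinHeightDisplay`).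
* MEMO bsd-cm-two v2.11 §22.1 (L) (Dvornicich–Zannier, Bull. SMF 129 (2001) Thm 3.1: local–global
  divisibility by a prime), (K) (the Kummer spaces of `E_p/K`), Cor 22.1; §23.
* A. Burungale, S. Kobayashi, K. Ota, S. Yasuda, J. Inst. Math. Jussieu (2023), Thm. 1.1 / 1.5 (p ≥ 5 inert).
* R. L. Miller, LMS J. Comput. Math. 14 (2011), Def. 1.1; parents: this seat's p512832 (`…YinLower`).
-/

set_option autoImplicit false
-- the Summit-side namespace `Summit.BirchSwinnertonDyer.BirchSwinnertonDyer.…` (summit = problem) is mandated by D-0017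
set_option linter.dupNamespace false

noncomputable section

open scoped Classical

open WeierstrassCurve WeierstrassCurve.Affine WeierstrassCurve.Affine.Point
  Summit.BirchSwinnertonDyer.BirchSwinnertonDyer.Theorems.SylvesterTwoCMNormForm
  Summit.BirchSwinnertonDyer.BirchSwinnertonDyer.Theorems.SylvesterTwoNonneg
  Literature.NumberTheory.EllipticCurves Literature.NumberTheory.EllipticCurves.HuShuYin2019
  Literature.NumberTheory.EllipticCurves.Rank1Residual.Typed

namespace Summit.BirchSwinnertonDyer.BirchSwinnertonDyer.Theorems.SylvesterTwoYinLower

/-! ## §1 Non-divisibility modulo torsion descends along any homomorphism -/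

/-- If the image of `Y` under an additive homomorphism is NOT of the form `2^j·Y′ + T′` (`T′` torsion),
then neither is `Y` (images of torsion elements are torsion). [folklore] -/
theorem not_powDivisible_of_map {M M' : Type*} [AddCommGroup M] [AddCommGroup M'] (f : M →+ M')
    {Y : M} {j : ℕ}
    (h : ¬ ∃ Y' T' : M', IsOfFinAddOrder T' ∧ f Y = ((2 : ℤ) ^ j) • Y' + T') :
    ¬ ∃ Y' T' : M, IsOfFinAddOrder T' ∧ Y = ((2 : ℤ) ^ j) • Y' + T' := by
  rintro ⟨Y', T', hT', rfl⟩
  exact h ⟨f Y', f T', f.isOfFinAddOrder hT', by rw [map_add, map_zsmul]⟩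

/-- Conversely, divisibility modulo torsion is preserved by any additive homomorphism. [folklore] -/
theorem powDivisible_map {M M' : Type*} [AddCommGroup M] [AddCommGroup M'] (f : M →+ M')
    {Y : M} {j : ℕ} (h : ∃ Y' T' : M, IsOfFinAddOrder T' ∧ Y = ((2 : ℤ) ^ j) • Y' + T') :
    ∃ Y' T' : M', IsOfFinAddOrder T' ∧ f Y = ((2 : ℤ) ^ j) • Y' + T' := by
  obtain ⟨Y', T', hT', rfl⟩ := h
  exact ⟨f Y', f T', f.isOfFinAddOrder hT', by rw [map_add, map_zsmul]⟩

/-! ## §2 (lowLoc) ⟹ (low): non-divisibility over some extension field suffices -/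

/-- **(lowLoc) ⟹ (low).** If, granted the facts, at every display datum `(K ∋ ω, P₀, Y, u)` of every
𝒞_HSY member and every `j` with `ord₂ #Ш(B)[2^∞] + 1 ≤ 2j + 2δ` there is an extension field `L/K` of
characteristic `0` over which `ι_L Y ∉ 2^j·B(L) + tors` (e.g. `L = K_𝔭`, `𝔭 = 2𝒪_K`: memo two Cor 22.1's
«`Y ∉ 2E_p(ℚ₄)`» on 𝒰 ∩ {k = 0}), then (low): `Y ∈ 2^j·B(K) + tors ⟹ 2j + 2δ ≤ ord₂ #Ш(B)[2^∞]`.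
One line over §1 with `ι_L = Point.baseChange K L`. [folklore] [cite: Miller2011LMS, Def. 1.1] -/
theorem low_of_lowLocal
    (hloc : Theses.SylvesterTwoHeegnerIndex.PublishedFactsTwo →
      ∀ (p : ℕ), p.Prime → (p % 9 = 4 ∨ p % 9 = 7) → (¬ ∃ x : ZMod p, x ^ 3 = 3) →
      ∀ (B : WeierstrassCurve ℚ) [B.IsElliptic] [B.IsGloballyMinimal],
        (∃ C : VariableChange ℚ, C • B = cubeSumCurve (p : ℚ)) → ∀ (qB : ℚ), shaAn B = (qB : ℂ) →
      ∀ (K : Type) [Field K] [NumberField K] (ω : K), ω ^ 2 + ω + 1 = 0 → Module.finrank ℚ K = 2 →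
      ∀ (P₀ : B.toAffine.Point), ¬ IsOfFinAddOrder (QuadraticDescent.incl K B P₀) →
        (∀ Q : B.toAffine.Point, ∃ m : ℤ,
          IsOfFinAddOrder (QuadraticDescent.incl K B Q - m • QuadraticDescent.incl K B P₀)) →
      ∀ (Y : (B.baseChange K).toAffine.Point) (u : ℚ), u ≠ 0 → padicValRat 2 u = 0 →
        ((u * qB : ℚ) : ℝ) * canonicalHeight (QuadraticDescent.incl K B P₀) =
          (2 : ℝ) ^ (if p % 9 = 4 then (0 : ℤ) else -2) * canonicalHeight Y →
      ∀ j : ℕ, (padicValNat 2 (Nat.card (AddCommGroup.primaryComponent B.sha 2)) : ℤ) + 1 ≤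
          2 * (j : ℤ) + (if p % 9 = 4 then (0 : ℤ) else -2) →
        ∃ (L : Type) (_ : Field L) (_ : CharZero L) (_ : Algebra K L),
          ¬ ∃ Y' T' : (B.baseChange L).toAffine.Point, IsOfFinAddOrder T' ∧
            Affine.Point.baseChange (W' := B) K L Y = ((2 : ℤ) ^ j) • Y' + T') :
    Theses.SylvesterTwoHeegnerIndex.PublishedFactsTwo →
      ∀ (p : ℕ), p.Prime → (p % 9 = 4 ∨ p % 9 = 7) → (¬ ∃ x : ZMod p, x ^ 3 = 3) →
      ∀ (B : WeierstrassCurve ℚ) [B.IsElliptic] [B.IsGloballyMinimal],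
        (∃ C : VariableChange ℚ, C • B = cubeSumCurve (p : ℚ)) → ∀ (qB : ℚ), shaAn B = (qB : ℂ) →
      ∀ (K : Type) [Field K] [NumberField K] (ω : K), ω ^ 2 + ω + 1 = 0 → Module.finrank ℚ K = 2 →
      ∀ (P₀ : B.toAffine.Point), ¬ IsOfFinAddOrder (QuadraticDescent.incl K B P₀) →
        (∀ Q : B.toAffine.Point, ∃ m : ℤ,
          IsOfFinAddOrder (QuadraticDescent.incl K B Q - m • QuadraticDescent.incl K B P₀)) →
      ∀ (Y : (B.baseChange K).toAffine.Point) (u : ℚ), u ≠ 0 → padicValRat 2 u = 0 →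
        ((u * qB : ℚ) : ℝ) * canonicalHeight (QuadraticDescent.incl K B P₀) =
          (2 : ℝ) ^ (if p % 9 = 4 then (0 : ℤ) else -2) * canonicalHeight Y →
      ∀ j : ℕ, (∃ Y' T' : (B.baseChange K).toAffine.Point,
          IsOfFinAddOrder T' ∧ Y = ((2 : ℤ) ^ j) • Y' + T') →
        2 * (j : ℤ) + (if p % 9 = 4 then (0 : ℤ) else -2) ≤
          (padicValNat 2 (Nat.card (AddCommGroup.primaryComponent B.sha 2)) : ℤ) := by
  intro hF p hp h9 h3 B _ _ hB qB hqB K _ _ ω hω h2K P₀ hP hgen Y u hu0 hu hid j hdiv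
  by_contra hlt
  obtain ⟨L, _, _, _, hL⟩ := hloc hF p hp h9 h3 B hB qB hqB K ω hω h2K P₀ hP hgen Y u hu0 hu hid j
    (by omega)
  exact not_powDivisible_of_map (Affine.Point.baseChange (W' := B) K L) hL hdiv

/-- **(low) ⟹ (lowLoc)** (with `L := K` itself): so the local residual is EQUIVALENT to (low) — its value
is the packaging, not extra strength. [folklore] -/
theorem lowLocal_of_low
    (hlow : Theses.SylvesterTwoHeegnerIndex.PublishedFactsTwo →
      ∀ (p : ℕ), p.Prime → (p % 9 = 4 ∨ p % 9 = 7) → (¬ ∃ x : ZMod p, x ^ 3 = 3) →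
      ∀ (B : WeierstrassCurve ℚ) [B.IsElliptic] [B.IsGloballyMinimal],
        (∃ C : VariableChange ℚ, C • B = cubeSumCurve (p : ℚ)) → ∀ (qB : ℚ), shaAn B = (qB : ℂ) →
      ∀ (K : Type) [Field K] [NumberField K] (ω : K), ω ^ 2 + ω + 1 = 0 → Module.finrank ℚ K = 2 →
      ∀ (P₀ : B.toAffine.Point), ¬ IsOfFinAddOrder (QuadraticDescent.incl K B P₀) →
        (∀ Q : B.toAffine.Point, ∃ m : ℤ,
          IsOfFinAddOrder (QuadraticDescent.incl K B Q - m • QuadraticDescent.incl K B P₀)) →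
      ∀ (Y : (B.baseChange K).toAffine.Point) (u : ℚ), u ≠ 0 → padicValRat 2 u = 0 →
        ((u * qB : ℚ) : ℝ) * canonicalHeight (QuadraticDescent.incl K B P₀) =
          (2 : ℝ) ^ (if p % 9 = 4 then (0 : ℤ) else -2) * canonicalHeight Y →
      ∀ j : ℕ, (∃ Y' T' : (B.baseChange K).toAffine.Point,
          IsOfFinAddOrder T' ∧ Y = ((2 : ℤ) ^ j) • Y' + T') →
        2 * (j : ℤ) + (if p % 9 = 4 then (0 : ℤ) else -2) ≤
          (padicValNat 2 (Nat.card (AddCommGroup.primaryComponent B.sha 2)) : ℤ)) :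
    Theses.SylvesterTwoHeegnerIndex.PublishedFactsTwo →
      ∀ (p : ℕ), p.Prime → (p % 9 = 4 ∨ p % 9 = 7) → (¬ ∃ x : ZMod p, x ^ 3 = 3) →
      ∀ (B : WeierstrassCurve ℚ) [B.IsElliptic] [B.IsGloballyMinimal],
        (∃ C : VariableChange ℚ, C • B = cubeSumCurve (p : ℚ)) → ∀ (qB : ℚ), shaAn B = (qB : ℂ) →
      ∀ (K : Type) [Field K] [NumberField K] (ω : K), ω ^ 2 + ω + 1 = 0 → Module.finrank ℚ K = 2 →
      ∀ (P₀ : B.toAffine.Point), ¬ IsOfFinAddOrder (QuadraticDescent.incl K B P₀) →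
        (∀ Q : B.toAffine.Point, ∃ m : ℤ,
          IsOfFinAddOrder (QuadraticDescent.incl K B Q - m • QuadraticDescent.incl K B P₀)) →
      ∀ (Y : (B.baseChange K).toAffine.Point) (u : ℚ), u ≠ 0 → padicValRat 2 u = 0 →
        ((u * qB : ℚ) : ℝ) * canonicalHeight (QuadraticDescent.incl K B P₀) =
          (2 : ℝ) ^ (if p % 9 = 4 then (0 : ℤ) else -2) * canonicalHeight Y →
      ∀ j : ℕ, (padicValNat 2 (Nat.card (AddCommGroup.primaryComponent B.sha 2)) : ℤ) + 1 ≤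
          2 * (j : ℤ) + (if p % 9 = 4 then (0 : ℤ) else -2) →
        ∃ (L : Type) (_ : Field L) (_ : CharZero L) (_ : Algebra K L),
          ¬ ∃ Y' T' : (B.baseChange L).toAffine.Point, IsOfFinAddOrder T' ∧
            Affine.Point.baseChange (W' := B) K L Y = ((2 : ℤ) ^ j) • Y' + T' := by
  intro hF p hp h9 h3 B _ _ hB qB hqB K _ _ ω hω h2K P₀ hP hgen Y u hu0 hu hid j hj
  refine ⟨K, inferInstance, inferInstance, inferInstance, ?_⟩
  intro hdivK
  -- `ι_K` is injective, so divisibility over `L = K` is divisibility in `B(K)`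
  have hinj : Function.Injective (Affine.Point.baseChange (W' := B) K K) := Affine.Point.map_injective _
  obtain ⟨Y', T', hT', hY⟩ := hdivK
  -- every point of `B(K)` viewed in `B(K ⊗ K) = B(K)` is in the image: use the identity section
  have hsurj : ∀ Z : (B.baseChange K).toAffine.Point,
      Affine.Point.baseChange (W' := B) K K Z = Z := fun Z => by
    cases Z <;> rfl
  rw [hsurj] at hY
  have h := hlow hF p hp h9 h3 B hB qB hqB K ω hω h2K P₀ hP hgen Y u hu0 hu hid j ⟨Y', T', hT', hY⟩
  omega

/-! ## §3 The LOWER cruxes BY NAME from Yin's display + (lowLoc) -/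

/-- **19477 `HeegnerIndexLowerAtTwoHSYOfFacts` ⟸ Yin's display + (lowLoc)** (§2 then part I's
`lowerOfFacts_of_yin_of_low`). A REDUCTION: a `2`-adic (or any-extension) non-divisibility theorem for
Yin's point closes the LOWER crux by name through this term. [cite: Miller2011LMS, §1 and Def. 1.1] -/
theorem lowerOfFacts_of_yin_of_lowLocal (hY : SylvesterTwoYin.YinHeightDisplay)
    (hloc : Theses.SylvesterTwoHeegnerIndex.PublishedFactsTwo →
      ∀ (p : ℕ), p.Prime → (p % 9 = 4 ∨ p % 9 = 7) → (¬ ∃ x : ZMod p, x ^ 3 = 3) →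
      ∀ (B : WeierstrassCurve ℚ) [B.IsElliptic] [B.IsGloballyMinimal],
        (∃ C : VariableChange ℚ, C • B = cubeSumCurve (p : ℚ)) → ∀ (qB : ℚ), shaAn B = (qB : ℂ) →
      ∀ (K : Type) [Field K] [NumberField K] (ω : K), ω ^ 2 + ω + 1 = 0 → Module.finrank ℚ K = 2 →
      ∀ (P₀ : B.toAffine.Point), ¬ IsOfFinAddOrder (QuadraticDescent.incl K B P₀) →
        (∀ Q : B.toAffine.Point, ∃ m : ℤ,
          IsOfFinAddOrder (QuadraticDescent.incl K B Q - m • QuadraticDescent.incl K B P₀)) →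
      ∀ (Y : (B.baseChange K).toAffine.Point) (u : ℚ), u ≠ 0 → padicValRat 2 u = 0 →
        ((u * qB : ℚ) : ℝ) * canonicalHeight (QuadraticDescent.incl K B P₀) =
          (2 : ℝ) ^ (if p % 9 = 4 then (0 : ℤ) else -2) * canonicalHeight Y →
      ∀ j : ℕ, (padicValNat 2 (Nat.card (AddCommGroup.primaryComponent B.sha 2)) : ℤ) + 1 ≤
          2 * (j : ℤ) + (if p % 9 = 4 then (0 : ℤ) else -2) →
        ∃ (L : Type) (_ : Field L) (_ : CharZero L) (_ : Algebra K L),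
          ¬ ∃ Y' T' : (B.baseChange L).toAffine.Point, IsOfFinAddOrder T' ∧
            Affine.Point.baseChange (W' := B) K L Y = ((2 : ℤ) ^ j) • Y' + T') :
    Theses.SylvesterTwoHeegnerIndex.HeegnerIndexLowerAtTwoHSYOfFacts :=
  lowerOfFacts_of_yin_of_low hY (low_of_lowLocal hloc)

/-- **The LIVE child 19891 `LowerOnV0HSY` BY NAME ⟸ Yin's display + (lowLoc).** [cite: Miller2011LMS, §1 and Def. 1.1] -/
theorem lowerOnV0HSY_of_yin_of_lowLocal (hY : SylvesterTwoYin.YinHeightDisplay)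
    (hloc : Theses.SylvesterTwoHeegnerIndex.PublishedFactsTwo →
      ∀ (p : ℕ), p.Prime → (p % 9 = 4 ∨ p % 9 = 7) → (¬ ∃ x : ZMod p, x ^ 3 = 3) →
      ∀ (B : WeierstrassCurve ℚ) [B.IsElliptic] [B.IsGloballyMinimal],
        (∃ C : VariableChange ℚ, C • B = cubeSumCurve (p : ℚ)) → ∀ (qB : ℚ), shaAn B = (qB : ℂ) →
      ∀ (K : Type) [Field K] [NumberField K] (ω : K), ω ^ 2 + ω + 1 = 0 → Module.finrank ℚ K = 2 →
      ∀ (P₀ : B.toAffine.Point), ¬ IsOfFinAddOrder (QuadraticDescent.incl K B P₀) →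
        (∀ Q : B.toAffine.Point, ∃ m : ℤ,
          IsOfFinAddOrder (QuadraticDescent.incl K B Q - m • QuadraticDescent.incl K B P₀)) →
      ∀ (Y : (B.baseChange K).toAffine.Point) (u : ℚ), u ≠ 0 → padicValRat 2 u = 0 →
        ((u * qB : ℚ) : ℝ) * canonicalHeight (QuadraticDescent.incl K B P₀) =
          (2 : ℝ) ^ (if p % 9 = 4 then (0 : ℤ) else -2) * canonicalHeight Y →
      ∀ j : ℕ, (padicValNat 2 (Nat.card (AddCommGroup.primaryComponent B.sha 2)) : ℤ) + 1 ≤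
          2 * (j : ℤ) + (if p % 9 = 4 then (0 : ℤ) else -2) →
        ∃ (L : Type) (_ : Field L) (_ : CharZero L) (_ : Algebra K L),
          ¬ ∃ Y' T' : (B.baseChange L).toAffine.Point, IsOfFinAddOrder T' ∧
            Affine.Point.baseChange (W' := B) K L Y = ((2 : ℤ) ^ j) • Y' + T') :
    Theses.SylvesterTwoHeegnerIndex.LowerOnV0HSY :=
  lowerOnV0HSY_of_yin_of_low hY (low_of_lowLocal hloc)

/-- **The LIVE child 19892 `LowerOffV0HSY` BY NAME ⟸ Yin's display + (lowLoc).** [cite: Miller2011LMS, §1 and Def. 1.1] -/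
theorem lowerOffV0HSY_of_yin_of_lowLocal (hY : SylvesterTwoYin.YinHeightDisplay)
    (hloc : Theses.SylvesterTwoHeegnerIndex.PublishedFactsTwo →
      ∀ (p : ℕ), p.Prime → (p % 9 = 4 ∨ p % 9 = 7) → (¬ ∃ x : ZMod p, x ^ 3 = 3) →
      ∀ (B : WeierstrassCurve ℚ) [B.IsElliptic] [B.IsGloballyMinimal],
        (∃ C : VariableChange ℚ, C • B = cubeSumCurve (p : ℚ)) → ∀ (qB : ℚ), shaAn B = (qB : ℂ) →
      ∀ (K : Type) [Field K] [NumberField K] (ω : K), ω ^ 2 + ω + 1 = 0 → Module.finrank ℚ K = 2 →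
      ∀ (P₀ : B.toAffine.Point), ¬ IsOfFinAddOrder (QuadraticDescent.incl K B P₀) →
        (∀ Q : B.toAffine.Point, ∃ m : ℤ,
          IsOfFinAddOrder (QuadraticDescent.incl K B Q - m • QuadraticDescent.incl K B P₀)) →
      ∀ (Y : (B.baseChange K).toAffine.Point) (u : ℚ), u ≠ 0 → padicValRat 2 u = 0 →
        ((u * qB : ℚ) : ℝ) * canonicalHeight (QuadraticDescent.incl K B P₀) =
          (2 : ℝ) ^ (if p % 9 = 4 then (0 : ℤ) else -2) * canonicalHeight Y →
      ∀ j : ℕ, (padicValNat 2 (Nat.card (AddCommGroup.primaryComponent B.sha 2)) : ℤ) + 1 ≤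
          2 * (j : ℤ) + (if p % 9 = 4 then (0 : ℤ) else -2) →
        ∃ (L : Type) (_ : Field L) (_ : CharZero L) (_ : Algebra K L),
          ¬ ∃ Y' T' : (B.baseChange L).toAffine.Point, IsOfFinAddOrder T' ∧
            Affine.Point.baseChange (W' := B) K L Y = ((2 : ℤ) ^ j) • Y' + T') :
    Theses.SylvesterTwoHeegnerIndex.LowerOffV0HSY :=
  lowerOffV0HSY_of_yin_of_low hY (low_of_lowLocal hloc)

end Summit.BirchSwinnertonDyer.BirchSwinnertonDyer.Theorems.SylvesterTwoYinLower

end
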